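import Summits.QuantumFields.YangMills.Theorems.UnitScaleTiltProp8HalvingMultiplierLetter
import Summits.QuantumFields.YangMills.Theorems.BalabanUVNodesK0FlatPortBodyP
import Literature.MathematicalPhysics.QuantumFieldTheory.Balaban1983to89.B8Prop3MultiLevelTorus
import Summits.QuantumFields.YangMills.Theorems.BalabanUVNodesK0Stub1PairingsAtExtensions
import HarnessLib

/-!
# K0⁷ STUB 1 (`stub_prop8StepCoP13`), sub-target S4b — **THE `q₀` LETTER FOR THE TRANSPOSE OF THE STRAIGHT MULTI-LEVEL AVERAGE AT EVERY FINE BOND**: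
# `w₃(b)·‖(Qᵗ X)(b)‖ ≤ 2·s` whenever `‖X_t‖ ≤ s·(L^{j(t)}η)` on the index bonds, for EVERY nested family on NODE 00's tori, every fine bond `b`, every transpose `Qᵗ`
# (w.r.t. `BE = η^dΣ_b τ`, `B = Σ_t τ`) of a block-diagonally rescaled straight average `Q = diag(ν)•Q_V`, `|ν| ≤ 1` — the multi-level twin of the route UnitScaleTilt's
# top-region transpose bound `HalvingMultiplierLetter.abs_QsE_apply_le_of_top` ([B5] (1.18): the column mass of `Q_j` is `L^{−jd}`; [B6] (2.3)–(2.4): the levels below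
# `j(b)` do not see `b`), with NO thresholds and NO constants beyond `2`

Cell `pub-ymgap`, width seat `pub-ymgap-k0-s1-w4` g0′ (FILE 6; reading (R1) of `pub-ymgap-k0-s1-w4/LOCATED-Q0-COMB.md`).  `--kind proof --supports stmt-QuantumFields-20541
--as helper`; count-neutral.  [15] = [Balaban1985Variational]; [B5] = [Balaban1984PropagatorsI]; [B6] = [Balaban1984PropagatorsII].

WHY.  The S4b capstone at the record (p612123 `K0Stub1SectFWSlotAtRecord.exists_sectF_W_atRecord_of_numericLetters(_anyQ)`) displays the column letter `hQt'` of the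
transpose `Qᵗ` of the multiplier term's average: `(∀ i, wB′ i·‖X i‖ ≤ s) → ∀ b, w 3 b·‖Qᵗ X b‖ ≤ q₀·s`.  For the EML linearisation `Qlin` no k-uniform `q₀` exists
(LOCATED-Q0-COMB: the coarse comb's transpose is `η^{1−d}Λᵀ∘div`).  For print's STRAIGHT averages ((45) p. 285; the tree's `Q_V` = extension of lit-balaban's `QE`, or its
block-diagonal rescaling `(Lʲη)•Q_V`) the transpose at a fine bond `b` with `Bʲ⁰(b₋) ∈ Ω_{j₀}` only sees the levels `j ≥ j₀` ([B6] (2.3)–(2.4): the index bonds of level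
`j < j₀` have non-deep end-points, `b`'s `j`-block is deep), and level `j` contributes at most its column mass `Σ_c Q_j(c,b) = L^{−jd}` ([B5] (1.18), lit-balaban
`B8Prop3MultiLevelTorus.sum_bondAvgIter_single`).  With the (152) weight `w₃(b) = (L^{j₀}η)³` (`j₀ = levOf b₋`), `d = 4`, and data `‖X_{(j,c)}‖ ≤ s·(Lʲη)` (the output block
weight `wB′ = (Lʲη)⁻¹` of this seat's FILE 4, on which `O₁` is k-uniform) the levels sum geometrically: `(L^{j₀}η)³η^{−4}Σ_{j≥j₀}L^{−4j}·s·Lʲη = s·Σ_{j≥j₀}L^{−3(j−j₀)} ≤ 2s`.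

WHAT IS PROVED (sorry-free; no definition; axioms standard).
* §1 (generic carrier `P`, nested family `D`) ★★ `abs_QsE_apply_le_of_inOm` — `|(Q*ω)(b)| ≤ Σ_{j₀ ≤ n ≤ k} (L^{−d})ⁿ·M_n` whenever `Bʲ⁰(b₋) ∈ Ω_{j₀}` and `|ω(c)| ≤ M_{j(c)}`
  (`M ≥ 0`); `levelSum_le` (`d = 4`: the geometric level sum `≤ 2s`).
* §2 (generic fibre) ★ `adjoint_apply_eq_kernel` — for a tracial `τ` with dualiser `ρ`, `BE Y δ = c·Σ_b τ(Y_b δ_b)` (`c ≠ 0`), `B X X′ = Σ_t τ(X_t X′_t)` and an average `Q`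
  with a real scalar kernel `r`, EVERY `Qᵗ` with `BE (Qᵗ X) δ = B X (Q δ)` is the kernel map `(Qᵗ X)(b) = c⁻¹·Σ_t r(t,b)•X_t` (uniqueness of the capstone's existential `Qt`);
  `norm_kernel_smul_sum_le_of_nonneg` (`‖Σ_t (r_t:ℂ)•X_t‖ ≤ Σ_t r_t‖X_t‖` for `r ≥ 0`).
* §3 (the record's tori) ★★★ `straightQt_letter_T4` — for every `F : T4Family`, `n, K`, every nested family `D` on `Site (F.P K) 0` with `D.k = K − n`, the (152) weights
  `w`, every normed `ℂ`-space fibre, every rescaling `ν` and every `Qᵗ` with the kernel `(Qᵗ X)(b) = (η^d)⁻¹•Σ_t (ν_t·Q_{j(t)}(t,b))•X_t` (p598821's `Qᵗ_V`: `ν ≡ 1`):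
  `(∀ t, |ν_t|·‖X t‖ ≤ s·(L^{j(t)}η)) → ∀ b, w 3 b·‖Qᵗ X b‖ ≤ 2·s` (`0 ≤ s`); ★★★ `adjointQt_letter_T4` — the same for EVERY `Qᵗ` adjoint (w.r.t. p598821's `BE`, `B`) to
  an average `Q` with kernel `ν_t·Q_{j(t)}(t,·)`; ★★★ `hQt'_unitWeight_of_adjoint_T4` (`|ν_t| ≤ L^{j(t)}η`, print's `(Lʲη)•Q_V`: the capstone's `hQt'` AS DISPLAYED with
  `wB′ := 1`, `q₀ := 2`) and ★★★ `hQt'_bandWeight_of_adjoint_T4` (`|ν| ≤ 1`, p598821's `Q_V`: `hQt'` with `wB′ i := (L^{j(i)}η)⁻¹`, `q₀ := 2`).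
* §4 (generic carrier) ★★ `hQ_scaledStraight_of_adm22` — the capstone's averaging letter `hQ` for print's `(Lʲη)•Q_V` at every `Adm22 D R M` family (`2L ≤ R·M`):
  `(∀ b, w 1 b·‖A′ b‖ ≤ r) → ∀ t, 1·‖Q A′ t‖ ≤ L·r` — the 𝔸-valued reading of k0-s1-w3's `QContrLetter` (`qContrLetter_of_adm22`, `C_Q = L`).
HONEST SCOPE.  Lattice bookkeeping over lit-balaban ∕ UST kernel theorems; the letters concern the STRAIGHT averages (45), NOT the transpose of `Qlin`; the choice of the
multiplier term's average and block weight in the capstone is the S2∕S4 lanes' decision ((87)∕(128) junction); nothing of Bałaban's analysis asserted; `stub_prop8StepCoP13` ∕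
K0⁷ NOT closed; N07 NOT discharged; counts unmoved (28∕28 · 5∕27); R4 closes the conditional finite-𝕋⁴ rung `BalabanLadder.UV` only, never the summit; the YM mass gap (Clay)
is NOT proved by any of this; nothing continuum ∕ ℝ⁴ ∕ OS.  No `sorry`, no `def`, no `instance`, no `notation`.
References: [15] (27) p.282, (45) p.285, (66) p.287, (87)–(88) p.291, (152) p.301; [B5] (1.11) p.19, (1.18) p.20; [B6] (2.3)–(2.4) p.224, (2.20) p.226; [Balaban1987RG1]
(0.1) p.251.
-/

set_option autoImplicit false

noncomputable section

open scoped BigOperators InnerProductSpace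

namespace Summit.QuantumFields.YangMills.Theorems.K0Stub1StraightQTransposeLetter

open Literature.MathematicalPhysics.QuantumFieldTheory.Balaban1983to89
open Literature.MathematicalPhysics.QuantumFieldTheory.Balaban1983to89.T4Continuum (T4Family)
open B6SectADomainsV1 (Domains)
open B6SectAOperatorsV1 (BondIdx BondIdxSpace QE QsE)
open B6AgreeQaQV1Chart (wxG sum_bondIdx_levels wxG_of_lam wxG_of_not_lam)
open LatticeFieldCalculus (bondAvgIter)
open B5Eq118OneStroke (iterBlockOf)
open B8Prop3MultiLevelTorus (sum_bondAvgIter_single bondAvgIter_single_nonneg)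
open B11Eq115Space (levOf mem_levOf)
open Summit.QuantumFields.YangMills.Theorems.HalvingMultiplierLetter (QsE_apply_eq_sum bondAvgIter_single_eq_zero_of_deep)
open Summit.QuantumFields.YangMills.Theorems.K0FlatCubeOpsTextP (IsLevWeight QContrLetter)
open Summit.QuantumFields.YangMills.Theorems.FlatOpsLettersAssembly (Qfun Qfun_apply)
open Summit.QuantumFields.YangMills.Theorems.FlatCubeOpsText (Adm22)
open Summit.QuantumFields.YangMills.Theorems.FlatScalarExtension (apply_eq_sum_kernel)
open Summit.QuantumFields.YangMills.Theorems.K0FlatPortBodyP (qContrLetter_of_adm22)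
open B9Eq39Adjoint (bondPair)
open Summit.QuantumFields.YangMills.Theorems.K0Stub1PairingsAtExtensions (bondPair_PBond_eq_sum)

/-! ## §1  The multi-level transpose of the straight averages at ANY fine bond (generic carrier) -/

section Generic

variable {P : Params} (D : Domains P)

/-- ★★ **THE TRANSPOSE OF THE MULTI-LEVEL STRAIGHT AVERAGE AT A FINE BOND OF `Ω_{j₀}`**: if `Bʲ⁰(b₋) ∈ Ω_{j₀}` (`InOm j₀ b₋`) and `|ω(c)| ≤ M_{j(c)}` on the index bonds
(`M ≥ 0`), then `|(Q*ω)(b)| ≤ Σ_{n = j₀}^{k} (L^{−d})ⁿ·M_n` — the levels `n < j₀` do not see `b` (their index bonds have non-deep end-points while `Bⁿ(b₋)` is deep: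
UST `bondAvgIter_single_eq_zero_of_deep`), and level `n` weighs at most its column mass `Σ_c Q_n(c,b) = (L^{−d})ⁿ` (lit-balaban `sum_bondAvgIter_single`, `Q_n(c,b) ≥ 0`).
Multi-level twin of UST `HalvingMultiplierLetter.abs_QsE_apply_le_of_top` (there `j₀ = k`). [cite: Balaban1984PropagatorsI, (1.11) p.19, (1.18) p.20; Balaban1984PropagatorsII, (2.3)-(2.4) p.224, (2.20) p.226] -/
theorem abs_QsE_apply_le_of_inOm (ω : BondIdxSpace D) {b : PBond P 0} {j₀ : ℕ} (hb : D.InOm j₀ b.src)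
    (M : ℕ → ℝ) (hM : ∀ n, 0 ≤ M n) (hω : ∀ c : BondIdx D, |ω c| ≤ M c.1.1) :
    |QsE D ω b| ≤ ∑ n ∈ Finset.range (D.k + 1), if j₀ ≤ n then (((P.L : ℝ) ^ P.d)⁻¹) ^ n * M n else 0 := by
  classical
  have hk : D.k ≤ P.m + P.K := D.hk
  rw [QsE_apply_eq_sum]
  have hlev := sum_bondIdx_levels D (fun c => ω c) (fun n β y => y * bondAvgIter n (Pi.single b (1 : ℝ)) β) (fun n β => zero_mul _)
  simp only at hlev
  rw [hlev]
  refine (Finset.abs_sum_le_sum_abs _ _).trans (Finset.sum_le_sum fun n hn => ?_)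
  have hn' : n ≤ D.k := Nat.lt_succ_iff.mp (Finset.mem_range.1 hn)
  by_cases hjn : j₀ ≤ n
  · rw [if_pos hjn]
    have hwx : ∀ β : PBond P n, |wxG D (fun c => ω c) n β| ≤ M n := by
      intro β
      by_cases hβ : D.LamBond n β
      · rw [wxG_of_lam D _ (Nat.lt_succ_of_le hn') hβ]; exact hω ⟨⟨⟨n, Nat.lt_succ_of_le hn'⟩, β⟩, hβ⟩
      · rw [wxG_of_not_lam D _ hβ, abs_zero]; exact hM n
    calc |∑ β : PBond P n, wxG D (fun c => ω c) n β * bondAvgIter n (Pi.single b (1 : ℝ)) β|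
        ≤ ∑ β : PBond P n, |wxG D (fun c => ω c) n β * bondAvgIter n (Pi.single b (1 : ℝ)) β| := Finset.abs_sum_le_sum_abs _ _
      _ ≤ ∑ β : PBond P n, M n * bondAvgIter n (Pi.single b (1 : ℝ)) β := Finset.sum_le_sum fun β _ => by
          rw [abs_mul, abs_of_nonneg (bondAvgIter_single_nonneg n b β)]
          exact mul_le_mul_of_nonneg_right (hwx β) (bondAvgIter_single_nonneg n b β)
      _ = M n * (((P.L : ℝ) ^ P.d)⁻¹) ^ n := by rw [← Finset.mul_sum, sum_bondAvgIter_single (le_trans hn' hk)]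
      _ = (((P.L : ℝ) ^ P.d)⁻¹) ^ n * M n := mul_comm _ _
  · rw [if_neg hjn]
    have hlt : n < j₀ := not_le.mp hjn
    rw [Finset.sum_eq_zero, abs_zero]
    intro β _
    by_cases hβ : D.LamBond n β
    · rw [bondAvgIter_single_eq_zero_of_deep D (le_trans hn' hk) β hβ.2.1 hβ.2.2 b
        ((D.deep_iterBlockOf_iff n b.src).2 (D.inOm_of_le (Nat.succ_le_of_lt hlt) hb)), mul_zero]
    · rw [wxG_of_not_lam D _ hβ, zero_mul]

end Generic

/-- **THE GEOMETRIC LEVEL SUM (`d = 4`)**: with `η = (Lᵏ)⁻¹`, `L ≥ 2`, `s ≥ 0`: `(L^{j₀}η)³·η⁻⁴·Σ_{j₀ ≤ n ≤ k}(L⁴)⁻ⁿ·s·(Lⁿη) = s·Σ_{n ≥ j₀}L^{−3(n−j₀)} ≤ 2s`.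
[cite: Balaban1985Variational, (152) p.301 (bookkeeping)] -/
theorem levelSum_le {Lr η s : ℝ} (hL : 2 ≤ Lr) (hs : 0 ≤ s) {k j₀ : ℕ} (hηk : η = (Lr ^ k)⁻¹) :
    (Lr ^ j₀ * η) ^ 3 * (η ^ 4)⁻¹ * ∑ n ∈ Finset.range (k + 1), (if j₀ ≤ n then ((Lr ^ 4)⁻¹) ^ n * (s * (Lr ^ n * η)) else 0) ≤ 2 * s := by
  have hL0 : 0 < Lr := by linarith
  have hη0 : η ≠ 0 := by rw [hηk]; positivity
  set q : ℝ := (Lr ^ 3)⁻¹ with hq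
  have hq0 : 0 ≤ q := by positivity
  have hq1 : q ≤ 1 / 2 := by
    rw [hq, inv_eq_one_div, div_le_div_iff₀ (by positivity) (by norm_num)]
    nlinarith [pow_le_pow_left₀ (by norm_num : (0:ℝ) ≤ 2) hL 3]
  -- each term: `(L^{j₀}η)^3 η^{-4} (L^{-4})^n s (L^n η) = s · q^{n-j₀}` for `n ≥ j₀`
  have hterm : ∀ n, j₀ ≤ n → (Lr ^ j₀ * η) ^ 3 * (η ^ 4)⁻¹ * (((Lr ^ 4)⁻¹) ^ n * (s * (Lr ^ n * η))) = s * q ^ (n - j₀) := by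
    intro n hn
    obtain ⟨e, rfl⟩ : ∃ e, n = j₀ + e := ⟨n - j₀, by omega⟩
    have ha : Lr ^ j₀ ≠ 0 := by positivity
    have hce : Lr ^ e ≠ 0 := by positivity
    have e1 : ((Lr ^ 4)⁻¹) ^ (j₀ + e) = ((Lr ^ j₀ * Lr ^ e) ^ 4)⁻¹ := by rw [inv_pow, ← pow_mul, mul_comm 4, pow_mul, pow_add]
    have e2 : q ^ e = ((Lr ^ e) ^ 3)⁻¹ := by rw [hq, inv_pow, ← pow_mul, mul_comm 3, pow_mul]
    rw [Nat.add_sub_cancel_left, e1, e2, pow_add]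
    field_simp
  rw [Finset.mul_sum]
  calc ∑ n ∈ Finset.range (k + 1), (Lr ^ j₀ * η) ^ 3 * (η ^ 4)⁻¹ * (if j₀ ≤ n then ((Lr ^ 4)⁻¹) ^ n * (s * (Lr ^ n * η)) else 0)
      = ∑ n ∈ Finset.range (k + 1), (if j₀ ≤ n then s * q ^ (n - j₀) else 0) := Finset.sum_congr rfl fun n _ => by
        split_ifs with h
        · exact hterm n h
        · rw [mul_zero]
    _ = ∑ n ∈ (Finset.range (k + 1)).filter (fun n => j₀ ≤ n), s * q ^ (n - j₀) := by rw [Finset.sum_filter]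
    _ ≤ ∑ n ∈ Finset.Ico j₀ (j₀ + (k + 1)), s * q ^ (n - j₀) := by
        refine Finset.sum_le_sum_of_subset_of_nonneg (fun n hn => ?_) fun n _ _ => by positivity
        rw [Finset.mem_filter, Finset.mem_range] at hn
        rw [Finset.mem_Ico]; omega
    _ = ∑ e ∈ Finset.range (k + 1), s * q ^ e := by
        rw [Finset.sum_Ico_eq_sum_range]; simp only [Nat.add_sub_cancel_left]
    _ = s * ∑ e ∈ Finset.Ico 0 (k + 1), q ^ e := by rw [← Finset.mul_sum, Finset.range_eq_Ico]
    _ ≤ s * (q ^ 0 / (1 - q)) := mul_le_mul_of_nonneg_left (geom_sum_Ico_le_of_lt_one hq0 (by linarith)) hs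
    _ ≤ s * 2 := mul_le_mul_of_nonneg_left (by rw [pow_zero, div_le_iff₀ (by linarith)]; linarith) hs
    _ = 2 * s := mul_comm _ _

/-! ## §2  The capstone's existential transpose IS the kernel map (generic fibre) -/

section Fibre

variable {ι κ 𝔸 : Type*} [Fintype ι] [Fintype κ] [DecidableEq ι] [NormedRing 𝔸] [NormedAlgebra ℂ 𝔸]

/-- ★ **UNIQUENESS OF THE TRANSPOSE**: for a tracial `τ` with dualiser `ρ` (`τ(ρℓ′·X) = ℓ′X`), the pairing `BE Y δ = c·Σ_b τ(Y_b δ_b)` (`c ≠ 0`), the block pairing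
`B X X′ = Σ_t τ(X_t X′_t)` and an average `Q` with a real scalar kernel `r` (`Q A t = Σ_b (r t b)•A b`), EVERY map `Qᵗ` with `BE (Qᵗ X) δ = B X (Q δ)` is the kernel map
`(Qᵗ X)(b) = c⁻¹•Σ_t (r t b)•X_t` (test against `δ := single b (ρℓ′)`; functionals separate points). [cite: Balaban1985Variational, (27) p.282, (66) p.287, (87)-(88) p.291] -/
theorem adjoint_apply_eq_kernel (τ : 𝔸 →L[ℂ] ℂ) (ρ : (𝔸 →L[ℂ] ℂ) →L[ℂ] 𝔸) (hρ : ∀ (ℓ' : 𝔸 →L[ℂ] ℂ) (X : 𝔸), τ (ρ ℓ' * X) = ℓ' X)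
    (hτ : ∀ a b : 𝔸, τ (a * b) = τ (b * a)) {c : ℂ} (hc : c ≠ 0)
    {BE : (ι → 𝔸) → (ι → 𝔸) → ℂ} (hBE : ∀ Y δ, BE Y δ = c * ∑ b, τ (Y b * δ b))
    {B : (κ → 𝔸) → (κ → 𝔸) → ℂ} (hB : ∀ X X', B X X' = ∑ t, τ (X t * X' t))
    {Q : (ι → 𝔸) → (κ → 𝔸)} (r : κ → ι → ℝ) (hQ : ∀ (A : ι → 𝔸) (t : κ), Q A t = ∑ b, ((r t b : ℝ) : ℂ) • A b)
    {Qt : (κ → 𝔸) → (ι → 𝔸)} (hQt : ∀ X δ, BE (Qt X) δ = B X (Q δ)) (X : κ → 𝔸) (b : ι) :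
    Qt X b = c⁻¹ • ∑ t, ((r t b : ℝ) : ℂ) • X t := by
  refine (SeparatingDual.eq_iff_forall_dual_eq (R := ℂ)).2 fun ℓ' => ?_
  have key := hQt X (Pi.single b (ρ ℓ'))
  rw [hBE, hB, Finset.sum_eq_single b (fun b' _ hb' => by rw [Pi.single_eq_of_ne hb', mul_zero, map_zero])
    (fun h => absurd (Finset.mem_univ _) h), Pi.single_eq_same, hτ, hρ] at key
  -- right side: `Σ_t τ(X_t · (r t b)•ρℓ′) = Σ_t (r t b)·ℓ′(X_t)`
  have hrhs : ∑ t, τ (X t * Q (Pi.single b (ρ ℓ')) t) = ∑ t, ((r t b : ℝ) : ℂ) * ℓ' (X t) := by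
    refine Finset.sum_congr rfl fun t _ => ?_
    rw [hQ, Finset.sum_eq_single b (fun b' _ hb' => by rw [Pi.single_eq_of_ne hb', smul_zero]) (fun h => absurd (Finset.mem_univ _) h),
      Pi.single_eq_same, mul_smul_comm, map_smul, smul_eq_mul, hτ, hρ]
  rw [hrhs] at key
  -- `ℓ′(Qt X b) = c⁻¹ Σ_t (r t b) ℓ′(X_t) = ℓ′(c⁻¹ • Σ_t (r t b)•X_t)`
  have h1 : ℓ' (Qt X b) = c⁻¹ * ∑ t, ((r t b : ℝ) : ℂ) * ℓ' (X t) := by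
    rw [← key, ← mul_assoc, inv_mul_cancel₀ hc, one_mul]
  rw [h1, map_smul, map_sum, smul_eq_mul]
  congr 1
  exact Finset.sum_congr rfl fun t _ => by rw [map_smul, smul_eq_mul]

omit [Fintype ι] [DecidableEq ι] [NormedRing 𝔸] [NormedAlgebra ℂ 𝔸] in
/-- `‖Σ_t (r_t:ℂ)•X_t‖ ≤ Σ_t r_t·‖X_t‖` for a nonnegative real kernel `r` (any normed `ℂ`-space). [folklore] -/
theorem norm_kernel_smul_sum_le_of_nonneg {V : Type*} [SeminormedAddCommGroup V] [NormedSpace ℂ V] (r : κ → ℝ) (hr : ∀ t, 0 ≤ r t) (X : κ → V) :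
    ‖∑ t, ((r t : ℝ) : ℂ) • X t‖ ≤ ∑ t, r t * ‖X t‖ :=
  (norm_sum_le _ _).trans (le_of_eq (Finset.sum_congr rfl fun t _ => by rw [norm_smul, Complex.norm_real, Real.norm_eq_abs, abs_of_nonneg (hr t)]))

end Fibre

/-! ## §3  NODE 00's four-tori: the letter in the capstone's currency -/

/-- ★★★ **THE `q₀` LETTER FOR THE TRANSPOSE OF A RESCALED STRAIGHT AVERAGE, EVERY FINE BOND, NO THRESHOLDS** — for every `F : T4Family`, `n, K`, every nested family `D` on
`Site (F.P K) 0` with `D.k = K − n`, the (152) weights `w`, every normed `ℂ`-space fibre `𝔸`, every real block rescaling `ν`, and every map `Qᵗ` with the kernel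
`(Qᵗ X)(b) = ((η:ℂ)^d)⁻¹•Σ_t (ν_t·Q_{j(t)}(t,b))•X_t` (p598821's `Qᵗ_V` is `ν ≡ 1`; the transpose of `(Lʲη)•Q_V` is `ν_t = L^{j(t)}η`), `η = (L⁻¹)^{K−n}`, `d = (F.P K).d`:
if `|ν_t|·‖X t‖ ≤ s·(L^{j(t)}η)` at every index bond (`0 ≤ s`) then `w 3 b·‖Qᵗ X b‖ ≤ 2·s` at EVERY fine bond `b` (both readings below are instances).
[cite: Balaban1985Variational, (45) p.285, (152) p.301, (27) p.282, (66) p.287; Balaban1984PropagatorsI, (1.18) p.20; Balaban1984PropagatorsII, (2.3)-(2.4) p.224, (2.20) p.226; Balaban1987RG1, (0.1) p.251] -/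
theorem straightQt_letter_T4 (F : T4Family) (n K : ℕ) (D : Domains (F.P K)) (hDk : D.k = K - n)
    {w : ℕ → PBond (F.P K) 0 → ℝ} (hw : IsLevWeight (F.P K) (K - n) D w)
    {𝔸 : Type*} [SeminormedAddCommGroup 𝔸] [NormedSpace ℂ 𝔸]
    (ν : BondIdx D → ℝ) (Qt : (BondIdx D → 𝔸) → (PBond (F.P K) 0 → 𝔸))
    (hQt : ∀ (X : BondIdx D → 𝔸) (b : PBond (F.P K) 0), Qt X b =
      (((((((F.P K).L : ℝ))⁻¹) ^ (K - n) : ℝ) : ℂ) ^ (F.P K).d)⁻¹ • ∑ t, ((ν t * bondAvgIter (t.1.1 : ℕ) (Pi.single b (1 : ℝ)) t.1.2 : ℝ) : ℂ) • X t)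
    (X : BondIdx D → 𝔸) (s : ℝ) (hs : 0 ≤ s)
    (hXt : ∀ t : BondIdx D, |ν t| * ‖X t‖ ≤ s * ((((F.P K).L : ℝ)) ^ (t.1.1 : ℕ) * ((((F.P K).L : ℝ))⁻¹) ^ (K - n))) (b : PBond (F.P K) 0) :
    w 3 b * ‖Qt X b‖ ≤ 2 * s := by
  classical
  -- letters
  have hL2 : (2 : ℝ) ≤ ((F.P K).L : ℝ) := by
    have : 11 < (F.P K).L := F.hL11
    exact_mod_cast (by omega : 2 ≤ (F.P K).L)
  have hL0 : (0 : ℝ) < ((F.P K).L : ℝ) := by linarith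
  set η : ℝ := ((((F.P K).L : ℝ))⁻¹) ^ (K - n) with hη
  have hη0 : 0 < η := by positivity
  have hηk : η = ((((F.P K).L : ℝ)) ^ (K - n))⁻¹ := by rw [hη, inv_pow]
  have hd : (F.P K).d = 4 := rfl
  -- the level of `b` and its weight
  set j₀ : ℕ := levOf (fun j => {x : Site (F.P K) 0 | D.InOm j x}) (K - n) b.src with hj₀
  have hb : D.InOm j₀ b.src := mem_levOf (Ω := fun j => {x : Site (F.P K) 0 | D.InOm j x}) (fun x => by
    show iterBlockOf 0 x ∈ D.Om 0; rw [D.Om_zero]; exact Finset.mem_univ _) (K - n) b.src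
  have hw3 : w 3 b = ((((F.P K).L : ℝ)) ^ j₀ * η) ^ 3 := hw 3 b
  -- the transpose as a weighted column of the straight averages
  have hcol : ‖∑ t, ((ν t * bondAvgIter (t.1.1 : ℕ) (Pi.single b (1 : ℝ)) t.1.2 : ℝ) : ℂ) • X t‖ ≤
      ∑ n ∈ Finset.range (D.k + 1), if j₀ ≤ n then ((((F.P K).L : ℝ) ^ (F.P K).d)⁻¹) ^ n * (s * ((((F.P K).L : ℝ)) ^ n * η)) else 0 := by
    -- `‖Σ‖ ≤ Σ_t Q(t,b)·(|ν t|‖X t‖) = (Q*ω)(b)` with `ω t := |ν t|‖X t‖`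
    have h1 : ‖∑ t, ((ν t * bondAvgIter (t.1.1 : ℕ) (Pi.single b (1 : ℝ)) t.1.2 : ℝ) : ℂ) • X t‖ ≤
        ∑ t, (|ν t| * ‖X t‖) * bondAvgIter (t.1.1 : ℕ) (Pi.single b (1 : ℝ)) t.1.2 := by
      refine (norm_sum_le _ _).trans (le_of_eq (Finset.sum_congr rfl fun t _ => ?_))
      rw [norm_smul, Complex.norm_real, Real.norm_eq_abs, abs_mul, abs_of_nonneg (bondAvgIter_single_nonneg _ b _), mul_right_comm]
    have h2 : ∑ t, (|ν t| * ‖X t‖) * bondAvgIter (t.1.1 : ℕ) (Pi.single b (1 : ℝ)) t.1.2 =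
        QsE D (WithLp.toLp 2 fun t => |ν t| * ‖X t‖) b := by
      rw [QsE_apply_eq_sum]
    have h3 := abs_QsE_apply_le_of_inOm D (WithLp.toLp 2 fun t => |ν t| * ‖X t‖) hb (fun n => s * ((((F.P K).L : ℝ)) ^ n * η))
      (fun n => by positivity) (fun c => by
        show |(|ν c| * ‖X c‖)| ≤ _
        rw [abs_of_nonneg (mul_nonneg (abs_nonneg _) (norm_nonneg _))]; exact hXt c)
    exact h1.trans ((le_abs_self _).trans (h2 ▸ h3))
  -- assemble: `w₃·η^{-4}·(column) ≤ 2s`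
  rw [hQt X b, norm_smul, norm_inv, norm_pow, Complex.norm_real, Real.norm_eq_abs, abs_of_pos hη0, hw3, hd]
  have hηk' : η = ((((F.P K).L : ℝ)) ^ D.k)⁻¹ := by rw [hDk]; exact hηk
  have hsum := levelSum_le (s := s) (k := D.k) (j₀ := j₀) hL2 hs hηk'
  calc ((((F.P K).L : ℝ)) ^ j₀ * η) ^ 3 * ((η ^ 4)⁻¹ * ‖∑ t, ((ν t * bondAvgIter (t.1.1 : ℕ) (Pi.single b (1 : ℝ)) t.1.2 : ℝ) : ℂ) • X t‖)
      ≤ ((((F.P K).L : ℝ)) ^ j₀ * η) ^ 3 * ((η ^ 4)⁻¹ *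
          ∑ n ∈ Finset.range (D.k + 1), (if j₀ ≤ n then ((((F.P K).L : ℝ) ^ 4)⁻¹) ^ n * (s * ((((F.P K).L : ℝ)) ^ n * η)) else 0)) :=
        mul_le_mul_of_nonneg_left (mul_le_mul_of_nonneg_left hcol (by positivity)) (by positivity)
    _ = _ := by rw [← mul_assoc]
    _ ≤ 2 * s := hsum

/-- ★★★ **THE CAPSTONE's TRANSPOSE IS THE KERNEL MAP, AND ITS LETTER** — for every `F : T4Family`, `n, K`, nested family `D` with `D.k = K − n`, (152) weights `w`, normed
`ℂ`-algebra fibre `𝔸` with a tracial `τ` and dualiser `ρ` (g0's `exists_fibreLetters`), the pairings `BE` = (27) (`bondPair`, p598821's `hBE`) and `B = Σ_t τ` (p598821's `hB`),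
every average `Q` with kernel `ν_t·Q_{j(t)}(t, ·)` (p598821's `Q_V`: `ν ≡ 1`; print's `(Lʲη)•Q_V`: `ν_t = L^{j(t)}η`) and EVERY `Qt` with `BE (Qt X) δ = B X (Q δ)` (the capstone's
existential transpose): `|ν_t|·‖X t‖ ≤ s·(L^{j(t)}η)` on the index bonds (`0 ≤ s`) ⇒ `w 3 b·‖Qt X b‖ ≤ 2·s` at every fine bond (§2's uniqueness + `straightQt_letter_T4`).
[cite: Balaban1985Variational, (27) p.282, (45) p.285, (66) p.287, (87)-(88) p.291, (152) p.301; Balaban1984PropagatorsI, (1.18) p.20; Balaban1984PropagatorsII, (2.3)-(2.4) p.224; Balaban1987RG1, (0.1) p.251] -/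
theorem adjointQt_letter_T4 (F : T4Family) (n K : ℕ) (D : Domains (F.P K)) (hDk : D.k = K - n)
    {w : ℕ → PBond (F.P K) 0 → ℝ} (hw : IsLevWeight (F.P K) (K - n) D w)
    {𝔸 : Type*} [NormedRing 𝔸] [NormedAlgebra ℂ 𝔸]
    (τ : 𝔸 →L[ℂ] ℂ) (ρ : (𝔸 →L[ℂ] ℂ) →L[ℂ] 𝔸) (hρ : ∀ (ℓ' : 𝔸 →L[ℂ] ℂ) (X : 𝔸), τ (ρ ℓ' * X) = ℓ' X) (hτ : ∀ a b : 𝔸, τ (a * b) = τ (b * a))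
    (BE : (PBond (F.P K) 0 → 𝔸) →L[ℂ] (PBond (F.P K) 0 → 𝔸) →L[ℂ] ℂ)
    (hBE : ∀ Y δ : PBond (F.P K) 0 → 𝔸, BE Y δ =
      bondPair (((((F.P K).L : ℝ))⁻¹) ^ (K - n)) (F.P K).d (τ : 𝔸 →ₗ[ℂ] ℂ) (fun μ x => Y ⟨x, μ⟩) (fun μ x => δ ⟨x, μ⟩))
    (B : (BondIdx D → 𝔸) →L[ℂ] (BondIdx D → 𝔸) →L[ℂ] ℂ) (hB : ∀ X X' : BondIdx D → 𝔸, B X X' = ∑ t, τ (X t * X' t))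
    (ν : BondIdx D → ℝ) (Q : (PBond (F.P K) 0 → 𝔸) →L[ℂ] (BondIdx D → 𝔸))
    (hQ : ∀ (A : PBond (F.P K) 0 → 𝔸) (t : BondIdx D), Q A t = ∑ j, ((ν t * WithLp.ofLp (QE D (WithLp.toLp 2 (Pi.single j 1))) t : ℝ) : ℂ) • A j)
    (Qt : (BondIdx D → 𝔸) →L[ℂ] (PBond (F.P K) 0 → 𝔸)) (hQt : ∀ X δ, BE (Qt X) δ = B X (Q δ))
    (X : BondIdx D → 𝔸) (s : ℝ) (hs : 0 ≤ s)
    (hXt : ∀ t : BondIdx D, |ν t| * ‖X t‖ ≤ s * ((((F.P K).L : ℝ)) ^ (t.1.1 : ℕ) * ((((F.P K).L : ℝ))⁻¹) ^ (K - n))) (b : PBond (F.P K) 0) :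
    w 3 b * ‖Qt X b‖ ≤ 2 * s := by
  have hL0 : (0 : ℝ) < ((F.P K).L : ℝ) := by exact_mod_cast (F.P K).L_pos
  have hc : (((((((F.P K).L : ℝ))⁻¹) ^ (K - n) : ℝ) : ℂ) ^ (F.P K).d) ≠ 0 :=
    pow_ne_zero _ (Complex.ofReal_ne_zero.mpr (by positivity))
  have hBE' : ∀ Y δ : PBond (F.P K) 0 → 𝔸, BE Y δ = (((((((F.P K).L : ℝ))⁻¹) ^ (K - n) : ℝ) : ℂ) ^ (F.P K).d) * ∑ b', τ (Y b' * δ b') := by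
    intro Y δ; rw [hBE, bondPair_PBond_eq_sum]; rfl
  have hQ' : ∀ (A : PBond (F.P K) 0 → 𝔸) (t : BondIdx D),
      Q A t = ∑ j, (((fun (t : BondIdx D) (j : PBond (F.P K) 0) => ν t * bondAvgIter (t.1.1 : ℕ) (Pi.single j (1 : ℝ)) t.1.2) t j : ℝ) : ℂ) • A j :=
    fun A t => hQ A t
  have hker := adjoint_apply_eq_kernel (ι := PBond (F.P K) 0) (κ := BondIdx D) τ ρ hρ hτ hc (BE := fun Y δ => BE Y δ) hBE' (B := fun X X' => B X X') hB
    (Q := fun A => Q A) _ hQ' (Qt := fun X => Qt X) hQt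
  exact straightQt_letter_T4 F n K D hDk hw ν (fun X => Qt X) hker X s hs hXt b

/-- ★★★ **THE CAPSTONE's `hQt'` AS DISPLAYED, PRINT's NORMALISATION, UNIT BLOCK WEIGHT**: in the setting of `adjointQt_letter_T4` with `|ν_t| ≤ L^{j(t)}η` (the transpose of
print's `(Lʲη)•Q_V`, (45) p. 285): `(∀ i, 1·‖X i‖ ≤ s) → ∀ b, w 3 b·‖Qt X b‖ ≤ 2·s` — the binder `hQt'` of p612123's `exists_sectF_W_atRecord_of_numericLetters_anyQ` with
`wB′ := 1`, `q₀ := 2` (pairs with this seat's `h3132_unitWeight_of_adm22_T4`, p616957). [cite: Balaban1985Variational, (45) p.285, (87)-(88) p.291, (152) p.301; Balaban1984PropagatorsI, (1.18) p.20] -/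
theorem hQt'_unitWeight_of_adjoint_T4 (F : T4Family) (n K : ℕ) (D : Domains (F.P K)) (hDk : D.k = K - n)
    {w : ℕ → PBond (F.P K) 0 → ℝ} (hw : IsLevWeight (F.P K) (K - n) D w)
    {𝔸 : Type*} [NormedRing 𝔸] [NormedAlgebra ℂ 𝔸]
    (τ : 𝔸 →L[ℂ] ℂ) (ρ : (𝔸 →L[ℂ] ℂ) →L[ℂ] 𝔸) (hρ : ∀ (ℓ' : 𝔸 →L[ℂ] ℂ) (X : 𝔸), τ (ρ ℓ' * X) = ℓ' X) (hτ : ∀ a b : 𝔸, τ (a * b) = τ (b * a))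
    (BE : (PBond (F.P K) 0 → 𝔸) →L[ℂ] (PBond (F.P K) 0 → 𝔸) →L[ℂ] ℂ)
    (hBE : ∀ Y δ : PBond (F.P K) 0 → 𝔸, BE Y δ =
      bondPair (((((F.P K).L : ℝ))⁻¹) ^ (K - n)) (F.P K).d (τ : 𝔸 →ₗ[ℂ] ℂ) (fun μ x => Y ⟨x, μ⟩) (fun μ x => δ ⟨x, μ⟩))
    (B : (BondIdx D → 𝔸) →L[ℂ] (BondIdx D → 𝔸) →L[ℂ] ℂ) (hB : ∀ X X' : BondIdx D → 𝔸, B X X' = ∑ t, τ (X t * X' t))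
    (ν : BondIdx D → ℝ) (hν : ∀ t : BondIdx D, |ν t| ≤ (((F.P K).L : ℝ)) ^ (t.1.1 : ℕ) * ((((F.P K).L : ℝ))⁻¹) ^ (K - n))
    (Q : (PBond (F.P K) 0 → 𝔸) →L[ℂ] (BondIdx D → 𝔸))
    (hQ : ∀ (A : PBond (F.P K) 0 → 𝔸) (t : BondIdx D), Q A t = ∑ j, ((ν t * WithLp.ofLp (QE D (WithLp.toLp 2 (Pi.single j 1))) t : ℝ) : ℂ) • A j)
    (Qt : (BondIdx D → 𝔸) →L[ℂ] (PBond (F.P K) 0 → 𝔸)) (hQt : ∀ X δ, BE (Qt X) δ = B X (Q δ))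
    (X : BondIdx D → 𝔸) (s : ℝ) (hs : 0 ≤ s) (hX : ∀ i : BondIdx D, (1 : ℝ) * ‖X i‖ ≤ s) (b : PBond (F.P K) 0) :
    w 3 b * ‖Qt X b‖ ≤ 2 * s :=
  adjointQt_letter_T4 F n K D hDk hw τ ρ hρ hτ BE hBE B hB ν Q hQ Qt hQt X s hs (fun t => by
    have h1 : ‖X t‖ ≤ s := by have := hX t; rwa [one_mul] at this
    calc |ν t| * ‖X t‖ ≤ ((((F.P K).L : ℝ)) ^ (t.1.1 : ℕ) * ((((F.P K).L : ℝ))⁻¹) ^ (K - n)) * s :=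
          mul_le_mul (hν t) h1 (norm_nonneg _) (le_trans (abs_nonneg _) (hν t))
      _ = _ := mul_comm _ _) b

/-- ★★★ **THE CAPSTONE's `hQt'` AS DISPLAYED, UNSCALED `Q_V`, BAND-EDGE BLOCK WEIGHT**: in the setting of `adjointQt_letter_T4` with `|ν_t| ≤ 1` (p598821's `Q_V`: `ν ≡ 1`):
`(∀ i, (L^{j(i)}η)⁻¹·‖X i‖ ≤ s) → ∀ b, w 3 b·‖Qt X b‖ ≤ 2·s` — `hQt'` with `wB′ i := (L^{j(i)}η)⁻¹` (the band edge of p616957's `h3132_of_adm22_T4`), `q₀ := 2`.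
[cite: Balaban1985Variational, (45) p.285, (87)-(88) p.291, (152) p.301; Balaban1984PropagatorsI, (1.18) p.20] -/
theorem hQt'_bandWeight_of_adjoint_T4 (F : T4Family) (n K : ℕ) (D : Domains (F.P K)) (hDk : D.k = K - n)
    {w : ℕ → PBond (F.P K) 0 → ℝ} (hw : IsLevWeight (F.P K) (K - n) D w)
    {𝔸 : Type*} [NormedRing 𝔸] [NormedAlgebra ℂ 𝔸]
    (τ : 𝔸 →L[ℂ] ℂ) (ρ : (𝔸 →L[ℂ] ℂ) →L[ℂ] 𝔸) (hρ : ∀ (ℓ' : 𝔸 →L[ℂ] ℂ) (X : 𝔸), τ (ρ ℓ' * X) = ℓ' X) (hτ : ∀ a b : 𝔸, τ (a * b) = τ (b * a))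
    (BE : (PBond (F.P K) 0 → 𝔸) →L[ℂ] (PBond (F.P K) 0 → 𝔸) →L[ℂ] ℂ)
    (hBE : ∀ Y δ : PBond (F.P K) 0 → 𝔸, BE Y δ =
      bondPair (((((F.P K).L : ℝ))⁻¹) ^ (K - n)) (F.P K).d (τ : 𝔸 →ₗ[ℂ] ℂ) (fun μ x => Y ⟨x, μ⟩) (fun μ x => δ ⟨x, μ⟩))
    (B : (BondIdx D → 𝔸) →L[ℂ] (BondIdx D → 𝔸) →L[ℂ] ℂ) (hB : ∀ X X' : BondIdx D → 𝔸, B X X' = ∑ t, τ (X t * X' t))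
    (ν : BondIdx D → ℝ) (hν : ∀ t : BondIdx D, |ν t| ≤ 1) (Q : (PBond (F.P K) 0 → 𝔸) →L[ℂ] (BondIdx D → 𝔸))
    (hQ : ∀ (A : PBond (F.P K) 0 → 𝔸) (t : BondIdx D), Q A t = ∑ j, ((ν t * WithLp.ofLp (QE D (WithLp.toLp 2 (Pi.single j 1))) t : ℝ) : ℂ) • A j)
    (Qt : (BondIdx D → 𝔸) →L[ℂ] (PBond (F.P K) 0 → 𝔸)) (hQt : ∀ X δ, BE (Qt X) δ = B X (Q δ))
    (X : BondIdx D → 𝔸) (s : ℝ) (hs : 0 ≤ s)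
    (hX : ∀ i : BondIdx D, (((F.P K).L : ℝ) ^ (i.1.1 : ℕ) * ((((F.P K).L : ℝ))⁻¹) ^ (K - n))⁻¹ * ‖X i‖ ≤ s) (b : PBond (F.P K) 0) :
    w 3 b * ‖Qt X b‖ ≤ 2 * s := by
  have hL0 : (0 : ℝ) < ((F.P K).L : ℝ) := by exact_mod_cast (F.P K).L_pos
  refine adjointQt_letter_T4 F n K D hDk hw τ ρ hρ hτ BE hBE B hB ν Q hQ Qt hQt X s hs (fun t => ?_) b
  have hwt : 0 < (((F.P K).L : ℝ)) ^ (t.1.1 : ℕ) * ((((F.P K).L : ℝ))⁻¹) ^ (K - n) := by positivity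
  have h1 : ‖X t‖ ≤ s * ((((F.P K).L : ℝ)) ^ (t.1.1 : ℕ) * ((((F.P K).L : ℝ))⁻¹) ^ (K - n)) := by
    have := hX t; rw [inv_mul_le_iff₀ hwt] at this; linarith
  calc |ν t| * ‖X t‖ ≤ 1 * ‖X t‖ := mul_le_mul_of_nonneg_right (hν t) (norm_nonneg _)
    _ ≤ _ := by rw [one_mul]; exact h1

/-! ## §4  The forward letter of print's `(Lʲη)•Q_V` (the capstone's `hQ`, generic carrier) -/

/-- ★★ **THE AVERAGING LETTER `hQ` OF THE CAPSTONE FOR PRINT's `(Lʲη)•Q_V`, `q = L`** (generic carrier `P`, every `Adm22 D R M` family with `2L ≤ R·M`, the (152) weights):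
for every normed `ℂ`-space fibre and every `Q` with the kernel `Q A t = Σ_j ((L^{j(t)}η)·Q_{j(t)}(t,j))•A j`: `(∀ b, w 1 b·‖A′ b‖ ≤ r) → ∀ t, 1·‖Q A′ t‖ ≤ L·r` — the 𝔸-valued
reading of k0-s1-w3's contraction row `QContrLetter` (`K0FlatPortBodyP.qContrLetter_of_adm22`, `C_Q = L`; (45): «L^jηQ_j is a convex combination», the level drops by at
most one across an index bond). [cite: Balaban1985Variational, (45) p.285, p.286; Balaban1984PropagatorsI, (1.18) p.20; Balaban1984PropagatorsII, (2.2) p.224, (2.20) p.226] -/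
theorem hQ_scaledStraight_of_adm22 {P : Params} (k : ℕ) (D : Domains P) (hDk : D.k = k) {R M : ℕ} (hAdm : Adm22 D R M) (hRM : 2 * P.L ≤ R * M)
    {w : ℕ → PBond P 0 → ℝ} (hw : IsLevWeight P k D w) {𝔸 : Type*} [SeminormedAddCommGroup 𝔸] [NormedSpace ℂ 𝔸]
    (Q : (PBond P 0 → 𝔸) → (BondIdx D → 𝔸))
    (hQ : ∀ (A : PBond P 0 → 𝔸) (t : BondIdx D), Q A t =
      ∑ j, ((((P.L : ℝ) ^ (t.1.1 : ℕ) * ((P.L : ℝ)⁻¹) ^ k) * WithLp.ofLp (QE D (WithLp.toLp 2 (Pi.single j 1))) t : ℝ) : ℂ) • A j)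
    (A' : PBond P 0 → 𝔸) (r : ℝ) (hA' : ∀ b, w 1 b * ‖A' b‖ ≤ r) (t : BondIdx D) : (1 : ℝ) * ‖Q A' t‖ ≤ (P.L : ℝ) * r := by
  classical
  have hL0 : (0 : ℝ) < (P.L : ℝ) := by exact_mod_cast P.L_pos
  have hw1 : ∀ b, 0 ≤ w 1 b := fun b => by rw [hw 1 b]; positivity
  have hr : 0 ≤ r := le_trans (mul_nonneg (hw1 _) (norm_nonneg _)) (hA' ⟨default, ⟨0, P.hd⟩⟩)
  have hν : 0 ≤ (P.L : ℝ) ^ (t.1.1 : ℕ) * ((P.L : ℝ)⁻¹) ^ k := by positivity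
  -- `‖Q A′ t‖ ≤ (L^{j(t)}η)·Σ_j Q(t,j)‖A′ j‖ = (L^{j(t)}η)·(Qfun ‖A′‖)(t)`
  have hsum : ∑ j, bondAvgIter (t.1.1 : ℕ) (Pi.single j (1 : ℝ)) t.1.2 * ‖A' j‖ = Qfun D (fun b => ‖A' b‖) t := by
    rw [apply_eq_sum_kernel]; exact Finset.sum_congr rfl fun j _ => by rw [mul_comm]; rfl
  have h1 : ‖Q A' t‖ ≤ ((P.L : ℝ) ^ (t.1.1 : ℕ) * ((P.L : ℝ)⁻¹) ^ k) * Qfun D (fun b => ‖A' b‖) t := by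
    rw [hQ, ← hsum, Finset.mul_sum]
    refine (norm_sum_le _ _).trans (le_of_eq (Finset.sum_congr rfl fun j _ => ?_))
    have hker : WithLp.ofLp (QE D (WithLp.toLp 2 (Pi.single j 1))) t = bondAvgIter (t.1.1 : ℕ) (Pi.single j (1 : ℝ)) t.1.2 := rfl
    rw [norm_smul, Complex.norm_real, Real.norm_eq_abs, abs_mul, abs_of_nonneg hν, hker, abs_of_nonneg (bondAvgIter_single_nonneg _ j _), mul_assoc]
  -- the contraction row of `Q`
  have hcontr := qContrLetter_of_adm22 (P := P) hDk hAdm hRM w hw (fun b => ‖A' b‖) r hr (fun b => by rw [abs_of_nonneg (norm_nonneg _)]; exact hA' b) t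
  have hQf : 0 ≤ Qfun D (fun b => ‖A' b‖) t := by
    rw [← hsum]; exact Finset.sum_nonneg fun j _ => mul_nonneg (bondAvgIter_single_nonneg _ j _) (norm_nonneg _)
  rw [abs_of_nonneg hQf] at hcontr
  rw [one_mul]
  exact h1.trans hcontr

end Summit.QuantumFields.YangMills.Theorems.K0Stub1StraightQTransposeLetter

end
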